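import Summits.AtomisticToContinuum.FouriersLaw.Theses.PhononMeanFreePath

/-!
# `BoundaryKubo` — reflection symmetry of the chain, antisymmetry of the steady current, and the
one-sided form of the limit clause (negative-side support, §6 of `Cruxes/BoundaryKubo/Disproof.lean`)

For crux `PhononMeanFreePath.BoundaryKubo` (stmt-AtomisticToContinuum-11812). The site reflection
`R : i ↦ N-1-i` of positions and momenta is a symmetry of every `OscillatorChain` with EVEN
interaction `V` (so odd force `V'`): `L_{a,b}(f ∘ R) = (L_{b,a} f) ∘ R` (`generator_comp_reflect'`),
`j_i ∘ R = -j_{N-2-i}` (`bondCurrent_reflect`), `totalCurrent(R_*μ) = -totalCurrent(μ)`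
(`totalCurrent_map_reflect`), and `R_*` maps weak steady states at bath temperatures `(a, b)` to
weak steady states at `(b, a)` (`isSteadyState_map_reflect`). For `pinnedChain` (FPU-β interaction,
even) under weak-NESS uniqueness this gives the antisymmetry `totalCurrent(μ M b a) =
-totalCurrent(μ M a b)` of the steady current of any steady family (`totalCurrent_antisymm`), hence
the response quotient `δ ↦ totalCurrent(μ (N+1) (T+δ/2) (T-δ/2))/δ` is EVEN on `|δ| < 2T`
(`responseQuotient_neg`) and the crux's two-sided limit clause is EQUIVALENT to the one-sided limit
`δ → 0⁺` (`tendsto_responseQuotient_iff`, any target value): provers may assume `T_L > T_R`, and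
finite-`δ` estimates of `D_{N+1}` carry an `O(δ²)` bias. Hypotheses are written out (weak-NESS
uniqueness at the parameter point = item 0741 there; a steady family) so that the file depends on the
Theses module only. All sorry-free; nothing closes the item.
-/

noncomputable section

namespace Summit.AtomisticToContinuum.FouriersLaw.Theorems.BoundaryKubo.Negative.Reflection

open MeasureTheory Filter Topology Set
open Literature.MathematicalPhysics.KineticTheory.HeatConduction

section Reflection
variable {N : ℕ}

/-- Site reflection `i ↦ N-1-i` of positions and momenta, as a continuous linear automorphism of
phase space (an involution). [folklore] -/
def reflectCLE (N : ℕ) : PhaseSpace N ≃L[ℝ] PhaseSpace N :=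
  ((LinearEquiv.funCongrLeft ℝ ℝ Fin.revPerm).prodCongr
    (LinearEquiv.funCongrLeft ℝ ℝ Fin.revPerm)).toContinuousLinearEquiv

/-- Reflected positions. [folklore] -/
@[simp] theorem reflectCLE_fst (x : PhaseSpace N) (i : Fin N) : (reflectCLE N x).1 i = x.1 (Fin.rev i) := rfl
/-- Reflected momenta. [folklore] -/
@[simp] theorem reflectCLE_snd (x : PhaseSpace N) (i : Fin N) : (reflectCLE N x).2 i = x.2 (Fin.rev i) := rfl

/-- Reflection is an involution. [folklore] -/
@[simp] theorem reflectCLE_reflectCLE (x : PhaseSpace N) : reflectCLE N (reflectCLE N x) = x := by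
  ext i <;> simp

/-- Line derivatives of `f ∘ R` are line derivatives of `f` along reflected directions (no
differentiability needed: both sides are `deriv`s of the same one-variable function). [folklore] -/
theorem lineDeriv_comp_reflect (f : PhaseSpace N → ℝ) (x v : PhaseSpace N) :
    lineDeriv ℝ (f ∘ reflectCLE N) x v = lineDeriv ℝ f (reflectCLE N x) (reflectCLE N v) := by
  unfold lineDeriv
  simp only [Function.comp_apply, map_add, map_smul]

/-- Reflection permutes the position coordinate directions. [folklore] -/
theorem reflect_unitQ (i : Fin N) :
    reflectCLE N ((Pi.single i 1, 0) : PhaseSpace N) = (Pi.single (Fin.rev i) 1, 0) := by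
  ext j
  · simp only [reflectCLE_fst, Pi.single_apply]
    by_cases h : j = Fin.rev i
    · subst h; simp
    · have : Fin.rev j ≠ i := fun h' => h (by rw [← h', Fin.rev_rev])
      simp [h, this]
  · simp

/-- Reflection permutes the momentum coordinate directions. [folklore] -/
theorem reflect_unitP (i : Fin N) :
    reflectCLE N ((0, Pi.single i 1) : PhaseSpace N) = (0, Pi.single (Fin.rev i) 1) := by
  ext j
  · simp
  · simp only [reflectCLE_snd, Pi.single_apply]
    by_cases h : j = Fin.rev i
    · subst h; simp
    · have : Fin.rev j ≠ i := fun h' => h (by rw [← h', Fin.rev_rev])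
      simp [h, this]

/-- `∂_{q_i}(f ∘ R) = (∂_{q_{N-1-i}} f) ∘ R`. [folklore] -/
theorem partialQ_comp_reflect (i : Fin N) (f : PhaseSpace N → ℝ) (x : PhaseSpace N) :
    partialQ i (f ∘ reflectCLE N) x = partialQ (Fin.rev i) f (reflectCLE N x) := by
  rw [partialQ_eq_lineDeriv, partialQ_eq_lineDeriv, lineDeriv_comp_reflect, reflect_unitQ]

/-- `∂_{p_i}(f ∘ R) = (∂_{p_{N-1-i}} f) ∘ R`. [folklore] -/
theorem partialP_comp_reflect (i : Fin N) (f : PhaseSpace N → ℝ) (x : PhaseSpace N) :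
    partialP i (f ∘ reflectCLE N) x = partialP (Fin.rev i) f (reflectCLE N x) := by
  rw [partialP_eq_lineDeriv, partialP_eq_lineDeriv, lineDeriv_comp_reflect, reflect_unitP]

/-- `∂²_{p_i}(f ∘ R) = (∂²_{p_{N-1-i}} f) ∘ R`. [folklore] -/
theorem partialP_partialP_comp_reflect (i : Fin N) (f : PhaseSpace N → ℝ) (x : PhaseSpace N) :
    partialP i (partialP i (f ∘ reflectCLE N)) x =
      partialP (Fin.rev i) (partialP (Fin.rev i) f) (reflectCLE N x) := by
  have h : partialP i (f ∘ reflectCLE N) = partialP (Fin.rev i) f ∘ reflectCLE N :=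
    funext (partialP_comp_reflect i f)
  rw [h, partialP_comp_reflect]

/-- The Hamiltonian is reflection invariant when the interaction is even. [folklore] -/
theorem hamiltonian_reflect (P : OscillatorChain) (hV : ∀ r, P.V (-r) = P.V r) (x : PhaseSpace N) :
    P.hamiltonian N (reflectCLE N x) = P.hamiltonian N x := by
  unfold OscillatorChain.hamiltonian
  simp only [reflectCLE_fst, reflectCLE_snd]
  congr 1
  · exact Equiv.sum_comp Fin.revPerm (fun i => x.2 i ^ 2 / 2 + P.U (x.1 i))
  · calc (∑ i : Fin N, ∑ j : Fin N,
          if j.val = i.val + 1 then P.V (x.1 (Fin.rev j) - x.1 (Fin.rev i)) else 0)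
        = ∑ i : Fin N, ∑ j : Fin N,
          if (Fin.rev j).val = (Fin.rev i).val + 1 then P.V (x.1 j - x.1 i) else 0 := by
          rw [← Equiv.sum_comp Fin.revPerm]
          refine Finset.sum_congr rfl fun i _ => ?_
          rw [← Equiv.sum_comp Fin.revPerm]
          refine Finset.sum_congr rfl fun j _ => ?_
          simp [Fin.rev_rev]
      _ = ∑ i : Fin N, ∑ j : Fin N, if i.val = j.val + 1 then P.V (x.1 j - x.1 i) else 0 := by
          refine Finset.sum_congr rfl fun i _ => Finset.sum_congr rfl fun j _ => ?_
          have hij : ((Fin.rev j).val = (Fin.rev i).val + 1) ↔ (i.val = j.val + 1) := by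
            rw [Fin.val_rev, Fin.val_rev]; omega
          rw [if_congr hij rfl rfl]
      _ = ∑ j : Fin N, ∑ i : Fin N, if i.val = j.val + 1 then P.V (x.1 j - x.1 i) else 0 :=
          Finset.sum_comm
      _ = _ := by
          refine Finset.sum_congr rfl fun i _ => Finset.sum_congr rfl fun j _ => ?_
          split_ifs
          · rw [← hV, neg_sub]
          · rfl

/-- Reflection covariance of the generator: `L_{a,b}(f ∘ R) = (L_{b,a} f) ∘ R`. [folklore] -/
theorem generator_comp_reflect (P : OscillatorChain) (hV : ∀ r, P.V (-r) = P.V r) (a b : ℝ)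
    (f : PhaseSpace N → ℝ) (y : PhaseSpace N) :
    P.generator N a b (f ∘ reflectCLE N) (reflectCLE N y) = P.generator N b a f y := by
  have hH : P.hamiltonian N ∘ reflectCLE N = P.hamiltonian N := funext (hamiltonian_reflect P hV)
  have hQH : ∀ i, partialQ i (P.hamiltonian N) (reflectCLE N y) =
      partialQ (Fin.rev i) (P.hamiltonian N) y := by
    intro i
    rw [← reflectCLE_reflectCLE y, ← partialQ_comp_reflect, hH, reflectCLE_reflectCLE]
  unfold OscillatorChain.generator
  simp only [partialQ_comp_reflect, partialP_comp_reflect, partialP_partialP_comp_reflect, hQH,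
    reflectCLE_reflectCLE, reflectCLE_snd]
  congr 1
  · exact Equiv.sum_comp Fin.revPerm
      (fun i => y.2 i * partialQ i f y - partialQ i (P.hamiltonian N) y * partialP i f y)
  · congr 1
    rw [← Equiv.sum_comp Fin.revPerm]
    refine Finset.sum_congr rfl fun j _ => ?_
    have h0 : ((Fin.rev j).val = 0) ↔ (j.val = N - 1) := by rw [Fin.val_rev]; omega
    have h1 : ((Fin.rev j).val = N - 1) ↔ (j.val = 0) := by rw [Fin.val_rev]; omega
    simp only [Fin.revPerm_apply, Fin.rev_rev]
    rw [if_congr h0 rfl rfl, if_congr h1 rfl rfl, add_comm]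

/-- Reflection covariance of the generator, unprimed form: `L_{a,b}(f ∘ R)(x) = L_{b,a} f (R x)`. [folklore] -/
theorem generator_comp_reflect' (P : OscillatorChain) (hV : ∀ r, P.V (-r) = P.V r) (a b : ℝ)
    (f : PhaseSpace N → ℝ) (x : PhaseSpace N) :
    P.generator N a b (f ∘ reflectCLE N) x = P.generator N b a f (reflectCLE N x) := by
  rw [← reflectCLE_reflectCLE x, generator_comp_reflect P hV, reflectCLE_reflectCLE]


/-- Reflection is a measurable embedding (a homeomorphism). [folklore] -/
theorem measurableEmbedding_reflect : MeasurableEmbedding (reflectCLE N) :=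
  (reflectCLE N).toHomeomorph.measurableEmbedding

/-- Closed form of the bond current on a genuine bond `(i, i+1)`. [folklore] -/
theorem bondCurrent_eq_of_lt (P : OscillatorChain) {i : Fin N} (h : i.val + 1 < N)
    (x : PhaseSpace N) :
    P.bondCurrent N i x =
      -((x.2 i + x.2 ⟨i.val + 1, h⟩) / 2 * deriv P.V (x.1 ⟨i.val + 1, h⟩ - x.1 i)) := by
  unfold OscillatorChain.bondCurrent
  rw [Finset.sum_eq_single ⟨i.val + 1, h⟩]
  · simp
  · intro j _ hj
    rw [if_neg]
    intro hv
    exact hj (Fin.ext hv)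
  · intro h'
    exact absurd (Finset.mem_univ _) h'

/-- No bond starts at the last site. [folklore] -/
theorem bondCurrent_eq_zero_of_not_lt (P : OscillatorChain) {i : Fin N} (h : ¬ i.val + 1 < N)
    (x : PhaseSpace N) : P.bondCurrent N i x = 0 := by
  unfold OscillatorChain.bondCurrent
  refine Finset.sum_eq_zero fun j _ => ?_
  rw [if_neg]
  intro hv
  exact h (hv ▸ j.isLt)

/-- The bond reflection `(i, i+1) ↦ (N-2-i, N-1-i)` (identity on the dummy last index). [folklore] -/
def bondRev (N : ℕ) (i : Fin N) : Fin N :=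
  if h : i.val + 1 < N then ⟨N - 2 - i.val, by omega⟩ else i

/-- Value of the bond reflection on a genuine bond. [folklore] -/
theorem bondRev_val_of_lt {i : Fin N} (h : i.val + 1 < N) : (bondRev N i).val = N - 2 - i.val := by
  simp [bondRev, h]

/-- The bond reflection fixes the dummy last index. [folklore] -/
theorem bondRev_of_not_lt {i : Fin N} (h : ¬ i.val + 1 < N) : bondRev N i = i := by
  simp [bondRev, h]

/-- The bond reflection is an involution. [folklore] -/
theorem bondRev_involutive : Function.Involutive (bondRev N) := by
  intro i
  by_cases h : i.val + 1 < N
  · have h2 : (bondRev N i).val + 1 < N := by rw [bondRev_val_of_lt h]; omega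
    apply Fin.ext
    rw [bondRev_val_of_lt h2, bondRev_val_of_lt h]
    omega
  · rw [bondRev_of_not_lt h, bondRev_of_not_lt h]

/-- The bond reflection as a permutation of `Fin N`. [folklore] -/
def bondRevPerm (N : ℕ) : Equiv.Perm (Fin N) := bondRev_involutive.toPerm (bondRev N)

/-- Unfolding `bondRevPerm`. [folklore] -/
@[simp] theorem bondRevPerm_apply (i : Fin N) : bondRevPerm N i = bondRev N i := rfl

/-- The force of an even interaction is odd (`deriv_comp_neg`, no differentiability needed). [folklore] -/
theorem deriv_V_neg (P : OscillatorChain) (hV : ∀ r, P.V (-r) = P.V r) (r : ℝ) :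
    deriv P.V (-r) = -deriv P.V r := by
  have h : P.V = fun s => P.V (-s) := funext fun s => (hV s).symm
  conv_lhs => rw [h]
  rw [deriv_comp_neg, neg_neg]

/-- Reflection reverses bond currents (for an even interaction, whose force is odd). [folklore] -/
theorem bondCurrent_reflect (P : OscillatorChain) (hV : ∀ r, P.V (-r) = P.V r) (i : Fin N)
    (x : PhaseSpace N) :
    P.bondCurrent N i (reflectCLE N x) = -P.bondCurrent N (bondRev N i) x := by
  by_cases h : i.val + 1 < N
  · have hk : (bondRev N i).val + 1 < N := by rw [bondRev_val_of_lt h]; omega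
    rw [bondCurrent_eq_of_lt P h, bondCurrent_eq_of_lt P hk]
    have e1 : Fin.rev i = ⟨(bondRev N i).val + 1, hk⟩ :=
      Fin.ext (by rw [Fin.val_rev]; simp only [bondRev_val_of_lt h]; omega)
    have e2 : Fin.rev (⟨i.val + 1, h⟩ : Fin N) = bondRev N i :=
      Fin.ext (by rw [Fin.val_rev, bondRev_val_of_lt h]; simp only; omega)
    simp only [reflectCLE_fst, reflectCLE_snd, e1, e2]
    rw [show x.1 (bondRev N i) - x.1 ⟨(bondRev N i).val + 1, hk⟩ =
        -(x.1 ⟨(bondRev N i).val + 1, hk⟩ - x.1 (bondRev N i)) by ring, deriv_V_neg P hV]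
    ring
  · rw [bondRev_of_not_lt h, bondCurrent_eq_zero_of_not_lt P h, bondCurrent_eq_zero_of_not_lt P h,
      neg_zero]

/-- Reflection reverses the total current of any measure. [folklore] -/
theorem totalCurrent_map_reflect (P : OscillatorChain) (hV : ∀ r, P.V (-r) = P.V r)
    (μ : Measure (PhaseSpace N)) :
    P.totalCurrent (μ.map (reflectCLE N)) = -P.totalCurrent μ := by
  unfold OscillatorChain.totalCurrent
  have hmap : ∀ i, ∫ x, P.bondCurrent N i x ∂(μ.map (reflectCLE N)) =
      -∫ x, P.bondCurrent N (bondRev N i) x ∂μ := by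
    intro i
    rw [measurableEmbedding_reflect.integral_map]
    simp_rw [bondCurrent_reflect P hV]
    exact integral_neg _
  simp_rw [hmap]
  rw [Finset.sum_neg_distrib]
  congr 1
  exact Equiv.sum_comp (bondRevPerm N) (fun i => ∫ x, P.bondCurrent N i x ∂μ)

/-- Reflection maps steady states at `(T_L, T_R) = (a, b)` to steady states at `(b, a)`. [folklore] -/
theorem isSteadyState_map_reflect (P : OscillatorChain) (hV : ∀ r, P.V (-r) = P.V r) {a b : ℝ}
    {μ : Measure (PhaseSpace N)} (h : P.IsSteadyState N a b μ) :
    P.IsSteadyState N b a (μ.map (reflectCLE N)) := by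
  obtain ⟨hprob, hgen, hint⟩ := h
  refine ⟨Measure.isProbabilityMeasure_map (reflectCLE N).continuous.measurable.aemeasurable,
    fun f hf hfc => ?_, fun i => ?_⟩
  · rw [measurableEmbedding_reflect.integral_map]
    simp_rw [← generator_comp_reflect' P hV a b f]
    exact hgen _ (hf.comp (reflectCLE N).contDiff) (hfc.comp_homeomorph (reflectCLE N).toHomeomorph)
  · rw [measurableEmbedding_reflect.integrable_map_iff]
    have hf : P.bondCurrent N i ∘ reflectCLE N = fun x => -P.bondCurrent N (bondRev N i) x :=
      funext fun x => bondCurrent_reflect P hV i x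
    rw [hf]
    exact (hint _).neg

/-- The FPU-β interaction of `pinnedChain` is even. [folklore] -/
theorem pinnedChain_V_even (ω₂ lam β γ r : ℝ) :
    (pinnedChain ω₂ lam β γ).V (-r) = (pinnedChain ω₂ lam β γ).V r := by
  show (-r) ^ 2 / 2 + β * (-r) ^ 4 / 4 = r ^ 2 / 2 + β * r ^ 4 / 4
  ring


/-- **Antisymmetry of the steady current** under exchange of the bath temperatures (reflection
symmetry + uniqueness). [folklore] -/
theorem totalCurrent_antisymm {ω₂ lam β γ : ℝ} (hU : ∀ (N : ℕ) (T_L T_R : ℝ), 0 < T_L → 0 < T_R → ∀ μ' ν' : Measure (PhaseSpace N),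
      (pinnedChain ω₂ lam β γ).IsSteadyState N T_L T_R μ' →
        (pinnedChain ω₂ lam β γ).IsSteadyState N T_L T_R ν' → μ' = ν')
    {μ : (M : ℕ) → ℝ → ℝ → Measure (PhaseSpace M)} (hμ : ∀ (N : ℕ) (T_L T_R : ℝ), 0 < T_L → 0 < T_R →
      (pinnedChain ω₂ lam β γ).IsSteadyState N T_L T_R (μ N T_L T_R))
    {a b : ℝ} (ha : 0 < a) (hb : 0 < b) (M : ℕ) :
    (pinnedChain ω₂ lam β γ).totalCurrent (μ M b a) =
      -(pinnedChain ω₂ lam β γ).totalCurrent (μ M a b) := by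
  have h1 := isSteadyState_map_reflect _ (pinnedChain_V_even ω₂ lam β γ) (hμ M a b ha hb)
  have h2 : μ M b a = (μ M a b).map (reflectCLE M) := hU M b a hb ha _ _ (hμ M b a hb ha) h1
  rw [h2, totalCurrent_map_reflect _ (pinnedChain_V_even ω₂ lam β γ)]

/-- Hence the response quotient `δ ↦ totalCurrent(μ (N+1) (T+δ/2) (T-δ/2))/δ` is EVEN on `|δ| < 2T`. [folklore] -/
theorem responseQuotient_neg {ω₂ lam β γ : ℝ} (hU : ∀ (N : ℕ) (T_L T_R : ℝ), 0 < T_L → 0 < T_R → ∀ μ' ν' : Measure (PhaseSpace N),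
      (pinnedChain ω₂ lam β γ).IsSteadyState N T_L T_R μ' →
        (pinnedChain ω₂ lam β γ).IsSteadyState N T_L T_R ν' → μ' = ν')
    {μ : (M : ℕ) → ℝ → ℝ → Measure (PhaseSpace M)} (hμ : ∀ (N : ℕ) (T_L T_R : ℝ), 0 < T_L → 0 < T_R →
      (pinnedChain ω₂ lam β γ).IsSteadyState N T_L T_R (μ N T_L T_R))
    {T δ : ℝ} (hδ : |δ| < 2 * T) (M : ℕ) :
    (pinnedChain ω₂ lam β γ).totalCurrent (μ M (T + -δ / 2) (T - -δ / 2)) / -δ =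
      (pinnedChain ω₂ lam β γ).totalCurrent (μ M (T + δ / 2) (T - δ / 2)) / δ := by
  have hlt := abs_lt.mp hδ
  have ha : 0 < T + δ / 2 := by linarith
  have hb : 0 < T - δ / 2 := by linarith
  rw [show T + -δ / 2 = T - δ / 2 by ring, show T - -δ / 2 = T + δ / 2 by ring,
    totalCurrent_antisymm hU hμ ha hb M, neg_div_neg_eq]

/-- … so the two-sided response limit of the crux is EQUIVALENT to the one-sided limit `δ → 0⁺`. [folklore] -/
theorem tendsto_responseQuotient_iff {ω₂ lam β γ : ℝ} (hU : ∀ (N : ℕ) (T_L T_R : ℝ), 0 < T_L → 0 < T_R → ∀ μ' ν' : Measure (PhaseSpace N),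
      (pinnedChain ω₂ lam β γ).IsSteadyState N T_L T_R μ' →
        (pinnedChain ω₂ lam β γ).IsSteadyState N T_L T_R ν' → μ' = ν')
    {μ : (M : ℕ) → ℝ → ℝ → Measure (PhaseSpace M)} (hμ : ∀ (N : ℕ) (T_L T_R : ℝ), 0 < T_L → 0 < T_R →
      (pinnedChain ω₂ lam β γ).IsSteadyState N T_L T_R (μ N T_L T_R))
    {T : ℝ} (hT : 0 < T) (M : ℕ) (K : ℝ) :
    Tendsto (fun δ : ℝ =>
        (pinnedChain ω₂ lam β γ).totalCurrent (μ M (T + δ / 2) (T - δ / 2)) / δ) (𝓝[≠] 0) (𝓝 K) ↔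
      Tendsto (fun δ : ℝ =>
        (pinnedChain ω₂ lam β γ).totalCurrent (μ M (T + δ / 2) (T - δ / 2)) / δ) (𝓝[>] 0) (𝓝 K) := by
  set g : ℝ → ℝ := fun δ =>
    (pinnedChain ω₂ lam β γ).totalCurrent (μ M (T + δ / 2) (T - δ / 2)) / δ with hg
  constructor
  · intro h
    exact h.mono_left (nhdsWithin_mono _ fun x hx => ne_of_gt hx)
  · intro h
    have hneg0 : Tendsto (fun δ : ℝ => -δ) (𝓝[<] (0 : ℝ)) (𝓝[>] (0 : ℝ)) := by
      rw [tendsto_nhdsWithin_iff]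
      constructor
      · have : Tendsto (fun δ : ℝ => -δ) (𝓝 (0 : ℝ)) (𝓝 (0 : ℝ)) := by
          simpa using (continuous_neg.tendsto (0 : ℝ))
        exact this.mono_left nhdsWithin_le_nhds
      · filter_upwards [self_mem_nhdsWithin] with δ hδ
        exact neg_pos.mpr (Set.mem_Iio.mp hδ)
    have hneg : Tendsto (fun δ : ℝ => g (-δ)) (𝓝[<] (0 : ℝ)) (𝓝 K) := h.comp hneg0
    have hev : (fun δ : ℝ => g (-δ)) =ᶠ[𝓝[<] (0 : ℝ)] g := by
      filter_upwards [Ioo_mem_nhdsLT (show -(2 * T) < 0 by linarith)] with δ hδ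
      simp only [hg]
      exact responseQuotient_neg hU hμ (abs_lt.mpr ⟨hδ.1, by linarith [hδ.2]⟩) M
    have hlt : Tendsto g (𝓝[<] (0 : ℝ)) (𝓝 K) := hneg.congr' hev
    rw [← nhdsLT_sup_nhdsGT]
    exact hlt.sup h


end Reflection

end Summit.AtomisticToContinuum.FouriersLaw.Theorems.BoundaryKubo.Negative.Reflection
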